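import Literature.MathematicalPhysics.QuantumFieldTheory.PointwiseOSReconstruction
import Literature.Probability.LatticeModels.ConformalCovariance
import HarnessLib

/-!
# Growth bound for the column configuration (`stub_column_growth`)

Crux `RotationUpgradeFromTwoPoint`, line `null-laplacian-edge-gaussianity`: from an abstract
"row-sum ⇒ product" bound `S N x ≤ ∏ t` (`t ≥ 1` dominating the row sums of the two-point
function), the decay `S 2 ![p, q] ≤ K r ^ (-2Δ)` (`r ≤ ‖p - q‖`, `Δ > 1/2`), nonnegativity,
vanishing diagonal, translation and time-reflection invariance, the value of `S` on `p` reflected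
bra points `θ (P i + 2J e₀)`, `q` ket points `Q j + 2J e₀` and the column `y ± (2 i + 1) e₀`
(`i < J`) is `≤ M * R ^ (2 J)`, `R = max 1 (2 K ∑ ℓ, (2 (ℓ + 1)) ^ (-2Δ))`, `M` free of `J`.
All estimates only use the heights: a column point (height `2 m + 1`, `-J ≤ m < J`) sees the other
column points through the even gaps `2 |m - m'|` (total weight `≤ 2 K ∑ ℓ ≥ 1, (2 ℓ) ^ (-2Δ) ≤ R`,
by injectivity of `m' ↦ m' - m`) and a special point of height `∓ (β + 2 J)` through a gap
`β + 2 n + 1`, `n ≥ 0` injective in the column point, bounded in total by the `J`-free tail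
`F β = ∑ n, K (β + 2 n + 1) ^ (-2Δ)`. Weights: `R (1 + spec)` on the column (`∑ spec ≤ ∑ F`,
`∏ (1 + spec) ≤ exp (∑ spec)`) and `J`-free constants on the special points.
-/

noncomputable section

open scoped BigOperators
open Literature.Probability.LatticeModels
open Literature.MathematicalPhysics.QuantumFieldTheory

namespace Summit.CriticalPhenomena.Ising3DConformalLimit.Cruxes.RotationUpgradeFromTwoPoint.NullLaplacianEdgeGaussianity

/-! ## Elementary tools -/

/-- A difference of time coordinates is bounded by the Euclidean distance. [folklore] -/
private theorem abs_sub_apply_le_norm (u v : EuclideanSpace ℝ (Fin 3)) :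
    |u 0 - v 0| ≤ ‖u - v‖ := by
  have h : ∀ w : EuclideanSpace ℝ (Fin 3), |w 0| ≤ ‖w‖ := fun w => by
    rw [EuclideanSpace.norm_eq, show |w 0| = Real.sqrt (‖w 0‖ ^ 2) by
      rw [Real.norm_eq_abs, Real.sqrt_sq (abs_nonneg _)]]
    exact Real.sqrt_le_sqrt
      (Finset.single_le_sum (f := fun k => ‖w k‖ ^ 2) (fun _ _ => sq_nonneg _) (Finset.mem_univ 0))
  simpa using h (u - v)

/-- Two-point bound from a lower bound on the gap of the heights, in both orders. [folklore] -/
private theorem gap_bound {Δ K : ℝ} {S : CorrFamily 3}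
    (h2pt : ∀ (p q : EuclideanSpace ℝ (Fin 3)) (r : ℝ), 0 < r → p ≠ q → r ≤ ‖p - q‖ →
      S 2 ![p, q] ≤ K * r ^ (-(2 * Δ)))
    {u v : EuclideanSpace ℝ (Fin 3)} {r : ℝ} (hr : 0 < r) (hruv : r ≤ |u 0 - v 0|) :
    S 2 ![u, v] ≤ K * r ^ (-(2 * Δ)) ∧ S 2 ![v, u] ≤ K * r ^ (-(2 * Δ)) := by
  have hne : u ≠ v := by
    rintro rfl
    exact absurd (by rwa [sub_self, abs_zero] at hruv) (not_le.mpr hr)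
  exact ⟨h2pt u v r hr hne (hruv.trans (abs_sub_apply_le_norm u v)),
    h2pt v u r hr hne.symm (hruv.trans ((abs_sub_comm (u 0) (v 0)).trans_le
      (abs_sub_apply_le_norm v u)))⟩

/-- Translation invariance of the two-point function. [folklore] -/
private theorem two_pt_translate {S : CorrFamily 3} (htr : IsTranslationInvariant S)
    (u w v : EuclideanSpace ℝ (Fin 3)) : S 2 ![u + v, w + v] = S 2 ![u, w] := by
  convert htr 2 v ![u, w] using 2
  funext l
  fin_cases l <;> simp

/-- `p`-series comparison: `∑ (u n) ^ (-2Δ)` converges when `u n ≥ n + 1` and `Δ > 1/2`.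
[folklore] -/
private theorem summable_rpow_of_le {Δ : ℝ} (hΔ : 1 / 2 < Δ) (u : ℕ → ℝ)
    (hu : ∀ n : ℕ, (n : ℝ) + 1 ≤ u n) : Summable (fun n => (u n) ^ (-(2 * Δ))) := by
  have hs : Summable (fun n : ℕ => ((n : ℝ) + 1) ^ (-(2 * Δ))) := by
    have h := (summable_nat_add_iff 1).mpr
      (Real.summable_nat_rpow.mpr (by linarith : -(2 * Δ) < -1))
    simpa using h
  refine Summable.of_nonneg_of_le (fun n => ?_) (fun n => ?_) hs
  · exact Real.rpow_nonneg (by linarith [hu n, (Nat.cast_nonneg n : (0 : ℝ) ≤ n)]) _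
  · exact Real.rpow_le_rpow_of_nonpos (by positivity) (hu n) (by linarith)

/-- A finite sum of values of a nonnegative summable function along an injection is bounded by
the total sum. [folklore] -/
private theorem sum_comp_le_tsum {ι κ : Type*} [Fintype ι] [DecidableEq κ] {f : κ → ℝ}
    (φ : ι → κ) (hφ : Function.Injective φ) (hf0 : ∀ k, 0 ≤ f k) (hf : Summable f) :
    ∑ i, f (φ i) ≤ ∑' k, f k := by
  rw [← Finset.sum_image (fun i _ j _ h => hφ h)]
  exact hf.sum_le_tsum _ (fun k _ => hf0 k)

/-- The even-gap sum along an injection `φ` into `ℤ`: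
`∑ i, [φ i ≠ 0] K (2 |φ i|) ^ (-2Δ) ≤ 2 K ∑ ℓ, (2 (ℓ + 1)) ^ (-2Δ)`. [folklore] -/
private theorem even_gap_sum_le {Δ K : ℝ} (hΔ : 1 / 2 < Δ) (hK : 0 ≤ K) {ι : Type*} [Fintype ι]
    (φ : ι → ℤ) (hφ : Function.Injective φ) :
    ∑ i, (if φ i = 0 then 0 else K * (2 * |((φ i : ℤ) : ℝ)|) ^ (-(2 * Δ)))
      ≤ 2 * K * ∑' ℓ : ℕ, ((2 : ℝ) * ((ℓ : ℝ) + 1)) ^ (-(2 * Δ)) := by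
  set G : ℤ → ℝ := fun z => if z = 0 then 0 else K * (2 * |(z : ℝ)|) ^ (-(2 * Δ)) with hG
  have hG0 : ∀ z, 0 ≤ G z := fun z => by
    simp only [hG]
    split_ifs
    exacts [le_rfl, by positivity]
  have hsum : Summable (fun n : ℕ => K * ((2 : ℝ) * ((n : ℝ) + 1)) ^ (-(2 * Δ))) :=
    (summable_rpow_of_le hΔ _ (fun n => by linarith)).mul_left K
  have hpos : ∀ n : ℕ, G ((n : ℤ) + 1) = K * ((2 : ℝ) * ((n : ℝ) + 1)) ^ (-(2 * Δ)) := fun n => by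
    simp only [hG, if_neg (show (n : ℤ) + 1 ≠ 0 by omega)]
    push_cast
    rw [abs_of_pos (by positivity)]
  have hneg : ∀ n : ℕ, G (-((n : ℤ) + 1)) = K * ((2 : ℝ) * ((n : ℝ) + 1)) ^ (-(2 * Δ)) := fun n => by
    simp only [hG, if_neg (show -((n : ℤ) + 1) ≠ 0 by omega)]
    push_cast
    rw [abs_neg, abs_of_pos (by positivity)]
  have h1 : Summable (fun n : ℕ => G ((n : ℤ) + 1)) := hsum.congr (fun n => (hpos n).symm)
  have h2 : Summable (fun n : ℕ => G (-((n : ℤ) + 1))) := hsum.congr (fun n => (hneg n).symm)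
  have hGs : Summable G := Summable.of_add_one_of_neg_add_one h1 h2
  calc ∑ i, G (φ i) ≤ ∑' z, G z := sum_comp_le_tsum φ hφ hG0 hGs
    _ = 2 * K * ∑' ℓ : ℕ, ((2 : ℝ) * ((ℓ : ℝ) + 1)) ^ (-(2 * Δ)) := by
      rw [tsum_of_add_one_of_neg_add_one h1 h2]
      simp only [hpos, hneg]
      rw [tsum_mul_left, hG]
      simp only [if_true]
      ring

/-- `∏ R (1 + s i) ≤ R ^ n * exp (∑ s i)` for `R, s ≥ 0`. [folklore] -/
private theorem prod_mul_one_add_le {ι : Type*} [Fintype ι] {R : ℝ} (hR : 0 ≤ R) (s : ι → ℝ)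
    (hs : ∀ i, 0 ≤ s i) : ∏ i, R * (1 + s i) ≤ R ^ Fintype.card ι * Real.exp (∑ i, s i) := by
  rw [Finset.prod_mul_distrib, Finset.prod_const, Finset.card_univ, Real.exp_sum]
  exact mul_le_mul_of_nonneg_left (Finset.prod_le_prod (fun i _ => by linarith [hs i])
    (fun i _ => by linarith [Real.add_one_le_exp (s i)])) (pow_nonneg hR _)

/-- Splitting a product over `Fin (m + n + l)` into its three blocks. [folklore] -/
@[to_additive /-- Splitting a sum over `Fin (m + n + l)` into its three blocks. [folklore] -/]
private theorem prod_three {M : Type*} [CommMonoid M] {m n l : ℕ} (f : Fin (m + n + l) → M) :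
    ∏ i, f i = (∏ i : Fin m, f (Fin.castAdd l (Fin.castAdd n i))) *
      (∏ j : Fin n, f (Fin.castAdd l (Fin.natAdd m j))) * ∏ k, f (Fin.natAdd (m + n) k) := by
  rw [Fin.prod_univ_add, Fin.prod_univ_add]

/-! ## The growth bound -/

/-- **Growth bound of the column configuration.** For a correlation family `S` on `ℝ³` with an
abstract row-sum domination `S N x ≤ ∏ t`, two-point decay `K r ^ (-2Δ)` (`Δ > 1/2`), nonnegative
two-point function vanishing on the diagonal, translation and time-reflection invariance, the value
of `S` on `p` reflected bra points pushed down by `2J`, `q` ket points pushed up by `2J` and the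
column `y ± (2 i + 1) e₀`, `i < J`, is `≤ M * (max 1 (2 K ∑ ℓ, (2 (ℓ + 1)) ^ (-2Δ))) ^ (2 J)`
with `M` independent of `J`. [folklore] -/
theorem stub_column_growth :
    ∀ (Δ K : ℝ) (S : CorrFamily 3), 1 / 2 < Δ → 0 ≤ K →
      (∀ (N : ℕ) (x : Fin N → EuclideanSpace ℝ (Fin 3)) (t : Fin N → ℝ),
        (∀ i, 1 ≤ t i) → (∀ i, ∑ j ∈ Finset.univ.erase i, S 2 ![x i, x j] ≤ t i) → S N x ≤ ∏ i, t i) →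
      (∀ (p q : EuclideanSpace ℝ (Fin 3)) (r : ℝ), 0 < r → p ≠ q → r ≤ ‖p - q‖ →
        S 2 ![p, q] ≤ K * r ^ (-(2 * Δ))) →
      (∀ p q : EuclideanSpace ℝ (Fin 3), 0 ≤ S 2 ![p, q]) →
      (∀ p : EuclideanSpace ℝ (Fin 3), S 2 ![p, p] = 0) →
      IsTranslationInvariant S →
      (∀ p q : EuclideanSpace ℝ (Fin 3), S 2 ![axisReflection 0 p, axisReflection 0 q] = S 2 ![p, q]) →
      ∀ (y : EuclideanSpace ℝ (Fin 3)), y 0 = 0 →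
      ∀ (p : ℕ) (P : Fin p → EuclideanSpace ℝ (Fin 3)) (q : ℕ) (Q : Fin q → EuclideanSpace ℝ (Fin 3)),
        (∀ i, 0 < P i 0) → (∀ j, 0 < Q j 0) →
        ∃ M : ℝ, ∀ J : ℕ,
          S ((p + q) + (J + J))
            (Fin.append
              (Fin.append (fun i => axisReflection 0 (P i + (2 * (J : ℝ)) • EuclideanSpace.single 0 1))
                (fun j => Q j + (2 * (J : ℝ)) • EuclideanSpace.single 0 1))
              (Fin.append (fun i : Fin J => y - (2 * (i : ℝ) + 1) • EuclideanSpace.single 0 1)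
                (fun i : Fin J => y + (2 * (i : ℝ) + 1) • EuclideanSpace.single 0 1)))
          ≤ M * (max 1 (2 * K * ∑' ℓ : ℕ, ((2 : ℝ) * ((ℓ : ℝ) + 1)) ^ (-(2 * Δ)))) ^ (2 * J) := by
  intro Δ K S hΔ hK hrow h2pt hnn hdiag htr hrefl y hy p P q Q hP hQ
  /- `J`-free quantities -/
  have hKr : ∀ r : ℝ, 0 ≤ r → 0 ≤ K * r ^ (-(2 * Δ)) :=
    fun r hr => mul_nonneg hK (Real.rpow_nonneg hr _)
  set s₀ : ℝ := ∑' ℓ : ℕ, ((2 : ℝ) * ((ℓ : ℝ) + 1)) ^ (-(2 * Δ))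
  set R : ℝ := max 1 (2 * K * s₀)
  have hR1 : 1 ≤ R := le_max_left _ _
  have hR0 : 0 ≤ R := zero_le_one.trans hR1
  -- the column tails `F β = ∑ n, K (β + 2 n + 1) ^ (-2Δ)`
  set F : ℝ → ℝ := fun β => ∑' n : ℕ, K * (β + 2 * (n : ℝ) + 1) ^ (-(2 * Δ))
  have hFs : ∀ β : ℝ, 0 ≤ β → Summable (fun n : ℕ => K * (β + 2 * (n : ℝ) + 1) ^ (-(2 * Δ))) :=
    fun β hβ => (summable_rpow_of_le hΔ _
      (fun n => by linarith [(Nat.cast_nonneg n : (0 : ℝ) ≤ n)])).mul_left K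
  have hF0 : ∀ β : ℝ, 0 ≤ β → 0 ≤ F β := fun β hβ =>
    tsum_nonneg (fun n => hKr _ (by linarith [(Nat.cast_nonneg n : (0 : ℝ) ≤ n)]))
  -- weights of the special points
  set tA : Fin p → ℝ := fun i₀ =>
    1 + ((∑ i', S 2 ![P i₀, P i']) + (∑ j', K * (P i₀ 0 + Q j' 0) ^ (-(2 * Δ))) + F (P i₀ 0))
    with htA
  set tB : Fin q → ℝ := fun j₀ =>
    1 + ((∑ i', K * (P i' 0 + Q j₀ 0) ^ (-(2 * Δ))) + (∑ j', S 2 ![Q j₀, Q j']) + F (Q j₀ 0))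
    with htB
  have htA1 : ∀ i, 1 ≤ tA i := fun i => by
    have h1 : 0 ≤ ∑ i', S 2 ![P i, P i'] := Finset.sum_nonneg (fun _ _ => hnn _ _)
    have h2 : 0 ≤ ∑ j', K * (P i 0 + Q j' 0) ^ (-(2 * Δ)) :=
      Finset.sum_nonneg (fun j _ => hKr _ (by linarith [hP i, hQ j]))
    linarith [hF0 (P i 0) (hP i).le]
  have htB1 : ∀ j, 1 ≤ tB j := fun j => by
    have h1 : 0 ≤ ∑ i', K * (P i' 0 + Q j 0) ^ (-(2 * Δ)) :=
      Finset.sum_nonneg (fun i _ => hKr _ (by linarith [hP i, hQ j]))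
    have h2 : 0 ≤ ∑ j', S 2 ![Q j, Q j'] := Finset.sum_nonneg (fun _ _ => hnn _ _)
    linarith [hF0 (Q j 0) (hQ j).le]
  set E₀ : ℝ := (∑ i, F (P i 0)) + ∑ j, F (Q j 0) with hE₀
  have hM0 : 0 ≤ (∏ i, tA i) * ∏ j, tB j :=
    mul_nonneg (Finset.prod_nonneg fun i _ => zero_le_one.trans (htA1 i))
      (Finset.prod_nonneg fun j _ => zero_le_one.trans (htB1 j))
  refine ⟨(∏ i, tA i) * (∏ j, tB j) * Real.exp E₀, fun J => ?_⟩
  /- the configuration at level `J` -/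
  have hJ : (0 : ℝ) ≤ J := Nat.cast_nonneg J
  set e : EuclideanSpace ℝ (Fin 3) := EuclideanSpace.single 0 1 with he
  set a : Fin p → EuclideanSpace ℝ (Fin 3) :=
    fun i => axisReflection 0 (P i + (2 * (J : ℝ)) • e) with ha
  set b : Fin q → EuclideanSpace ℝ (Fin 3) := fun j => Q j + (2 * (J : ℝ)) • e with hb
  set col : Fin (J + J) → EuclideanSpace ℝ (Fin 3) :=
    Fin.append (fun i : Fin J => y - (2 * (i : ℝ) + 1) • e)
      (fun i : Fin J => y + (2 * (i : ℝ) + 1) • e) with hcol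
  set x : Fin ((p + q) + (J + J)) → EuclideanSpace ℝ (Fin 3) :=
    Fin.append (Fin.append a b) col with hx
  show S ((p + q) + (J + J)) x ≤ _
  -- the column index `m ∈ [-J, J)`: the `k`-th column point sits at height `2 m + 1`
  set idx : Fin (J + J) → ℤ :=
    fun k => if (k : ℕ) < J then -((k : ℕ) : ℤ) - 1 else ((k : ℕ) : ℤ) - J with hidx
  have hidx_inj : Function.Injective idx := fun k k' h => by
    simp only [hidx] at h
    apply Fin.ext
    split_ifs at h <;> omega
  have hidx_bd : ∀ k, 0 ≤ idx k + J ∧ 0 ≤ (J : ℤ) - 1 - idx k := fun k => by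
    have hk := k.is_lt
    simp only [hidx]
    split_ifs <;> omega
  -- heights
  have ha0 : ∀ i, a i 0 = -(P i 0 + 2 * J) := fun i => by
    simp [ha, he]
    ring
  have hb0 : ∀ j, b j 0 = Q j 0 + 2 * J := fun j => by simp [hb, he]
  have hc0 : ∀ k, col k 0 = 2 * (idx k : ℝ) + 1 := fun k => by
    induction k using Fin.addCases with
    | left i =>
      simp [hcol, hidx, he, hy, Fin.append_left, Fin.val_castAdd, i.is_lt]
      ring
    | right i =>
      simp only [hcol, hidx, Fin.append_right, Fin.val_natAdd, add_lt_iff_neg_left, not_lt_zero,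
        if_false]
      simp [he, hy]
  -- the two injections of the column into `ℕ` seen from below and from above
  have hφ1 : ∀ k, (((idx k + J).toNat : ℕ) : ℝ) = (idx k : ℝ) + J := fun k => by
    exact_mod_cast congrArg (Int.cast : ℤ → ℝ) (Int.toNat_of_nonneg (hidx_bd k).1)
  have hφ2 : ∀ k, ((((J : ℤ) - 1 - idx k).toNat : ℕ) : ℝ) = (J : ℝ) - 1 - idx k := fun k => by
    exact_mod_cast congrArg (Int.cast : ℤ → ℝ) (Int.toNat_of_nonneg (hidx_bd k).2)
  have hφ1i : Function.Injective (fun k => (idx k + J).toNat) := fun k k' h => by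
    have h' : (idx k + J).toNat = (idx k' + J).toNat := h
    have h1 := hidx_bd k
    have h2 := hidx_bd k'
    exact hidx_inj (by omega)
  have hφ2i : Function.Injective (fun k => ((J : ℤ) - 1 - idx k).toNat) := fun k k' h => by
    have h' : ((J : ℤ) - 1 - idx k).toNat = ((J : ℤ) - 1 - idx k').toNat := h
    have h1 := hidx_bd k
    have h2 := hidx_bd k'
    exact hidx_inj (by omega)
  /- pointwise two-point bounds -/
  have gab : ∀ i j, S 2 ![a i, b j] ≤ K * (P i 0 + Q j 0) ^ (-(2 * Δ)) ∧
      S 2 ![b j, a i] ≤ K * (P i 0 + Q j 0) ^ (-(2 * Δ)) := fun i j => by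
    refine gap_bound h2pt (by linarith [hP i, hQ j]) ?_
    rw [ha0, hb0]
    exact le_abs.mpr (Or.inr (by linarith [hP i, hQ j]))
  have gac : ∀ i k, S 2 ![a i, col k] ≤ K * (P i 0 + 2 * ((idx k : ℝ) + J) + 1) ^ (-(2 * Δ)) ∧
      S 2 ![col k, a i] ≤ K * (P i 0 + 2 * ((idx k : ℝ) + J) + 1) ^ (-(2 * Δ)) := fun i k => by
    have hk : (0 : ℝ) ≤ (idx k : ℝ) + J := by exact_mod_cast (hidx_bd k).1
    refine gap_bound h2pt (by linarith [hP i]) ?_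
    rw [ha0, hc0]
    exact le_abs.mpr (Or.inr (by linarith))
  have gbc : ∀ j k, S 2 ![b j, col k] ≤ K * (Q j 0 + 2 * ((J : ℝ) - 1 - idx k) + 1) ^ (-(2 * Δ)) ∧
      S 2 ![col k, b j] ≤ K * (Q j 0 + 2 * ((J : ℝ) - 1 - idx k) + 1) ^ (-(2 * Δ)) := fun j k => by
    have hk : (0 : ℝ) ≤ (J : ℝ) - 1 - idx k := by exact_mod_cast (hidx_bd k).2
    refine gap_bound h2pt (by linarith [hQ j]) ?_
    rw [hb0, hc0]
    exact le_abs.mpr (Or.inl (by linarith))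
  have gcc : ∀ k k', S 2 ![col k, col k'] ≤
      (if idx k' - idx k = 0 then 0 else K * (2 * |((idx k' - idx k : ℤ) : ℝ)|) ^ (-(2 * Δ))) := by
    intro k k'
    split_ifs with h
    · rw [show k' = k from hidx_inj (by omega)]
      exact (hdiag _).le
    · have h' : ((idx k' - idx k : ℤ) : ℝ) ≠ 0 := by exact_mod_cast h
      refine (gap_bound h2pt (by positivity) ?_).1
      rw [hc0, hc0]
      push_cast
      rw [show (2 : ℝ) * (idx k : ℝ) + 1 - (2 * (idx k' : ℝ) + 1) = -(2 * ((idx k' : ℝ) - idx k)) by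
        ring, abs_neg, abs_mul, abs_two]
  have gaa : ∀ i i', S 2 ![a i, a i'] = S 2 ![P i, P i'] := fun i i' => by
    simp only [ha]
    rw [hrefl, two_pt_translate htr]
  have gbb : ∀ j j', S 2 ![b j, b j'] = S 2 ![Q j, Q j'] := fun j j' => by
    simp only [hb]
    rw [two_pt_translate htr]
  /- column sums -/
  have sumA : ∀ i, ∑ k, K * (P i 0 + 2 * ((idx k : ℝ) + J) + 1) ^ (-(2 * Δ)) ≤ F (P i 0) := fun i => by
    have h := sum_comp_le_tsum (f := fun n : ℕ => K * (P i 0 + 2 * (n : ℝ) + 1) ^ (-(2 * Δ))) _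
      hφ1i (fun n => hKr _ (by linarith [hP i, (Nat.cast_nonneg n : (0 : ℝ) ≤ n)]))
      (hFs _ (hP i).le)
    simp only [hφ1] at h
    exact h
  have sumB : ∀ j, ∑ k, K * (Q j 0 + 2 * ((J : ℝ) - 1 - idx k) + 1) ^ (-(2 * Δ)) ≤ F (Q j 0) := fun j => by
    have h := sum_comp_le_tsum (f := fun n : ℕ => K * (Q j 0 + 2 * (n : ℝ) + 1) ^ (-(2 * Δ))) _
      hφ2i (fun n => hKr _ (by linarith [hQ j, (Nat.cast_nonneg n : (0 : ℝ) ≤ n)]))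
      (hFs _ (hQ j).le)
    simp only [hφ2] at h
    exact h
  have sumC : ∀ k, ∑ k', S 2 ![col k, col k'] ≤ R := fun k =>
    le_trans ((Finset.sum_le_sum (fun k' _ => gcc k k')).trans (even_gap_sum_le hΔ hK
      (fun k' => idx k' - idx k) (fun k₁ k₂ h => hidx_inj (by
        have h' : idx k₁ - idx k = idx k₂ - idx k := h
        omega)))) (le_max_right _ _)
  /- the weights -/
  set spec : Fin (J + J) → ℝ := fun k =>
    (∑ i', K * (P i' 0 + 2 * ((idx k : ℝ) + J) + 1) ^ (-(2 * Δ))) +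
      ∑ j', K * (Q j' 0 + 2 * ((J : ℝ) - 1 - idx k) + 1) ^ (-(2 * Δ)) with hspec
  have hspec0 : ∀ k, 0 ≤ spec k := fun k => by
    have hk1 : (0 : ℝ) ≤ (idx k : ℝ) + J := by exact_mod_cast (hidx_bd k).1
    have hk2 : (0 : ℝ) ≤ (J : ℝ) - 1 - idx k := by exact_mod_cast (hidx_bd k).2
    exact add_nonneg (Finset.sum_nonneg fun i _ => hKr _ (by linarith [hP i]))
      (Finset.sum_nonneg fun j _ => hKr _ (by linarith [hQ j]))
  have hspec_sum : ∑ k, spec k ≤ E₀ := by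
    have hA : ∑ k, ∑ i', K * (P i' 0 + 2 * ((idx k : ℝ) + J) + 1) ^ (-(2 * Δ))
        ≤ ∑ i', F (P i' 0) := by
      rw [Finset.sum_comm]
      exact Finset.sum_le_sum fun i' _ => sumA i'
    have hB : ∑ k, ∑ j', K * (Q j' 0 + 2 * ((J : ℝ) - 1 - idx k) + 1) ^ (-(2 * Δ))
        ≤ ∑ j', F (Q j' 0) := by
      rw [Finset.sum_comm]
      exact Finset.sum_le_sum fun j' _ => sumB j'
    simp only [hspec, hE₀]
    rw [Finset.sum_add_distrib]
    exact add_le_add hA hB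
  set t : Fin ((p + q) + (J + J)) → ℝ :=
    Fin.append (Fin.append tA tB) (fun k => R * (1 + spec k)) with ht
  have ht1 : ∀ i, 1 ≤ t i := by
    intro i
    induction i using Fin.addCases with
    | left i =>
      induction i using Fin.addCases with
      | left i₀ =>
        simp only [ht, Fin.append_left]
        exact htA1 i₀
      | right j₀ =>
        simp only [ht, Fin.append_left, Fin.append_right]
        exact htB1 j₀
    | right k =>
      simp only [ht, Fin.append_right]
      calc (1 : ℝ) ≤ R := hR1
        _ ≤ R * (1 + spec k) := le_mul_of_one_le_right hR0 (by linarith [hspec0 k])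
  have ht2 : ∀ i, ∑ j ∈ Finset.univ.erase i, S 2 ![x i, x j] ≤ t i := by
    intro i
    refine (Finset.sum_le_sum_of_subset_of_nonneg (f := fun j => S 2 ![x i, x j])
      (Finset.erase_subset i Finset.univ) (fun j _ _ => hnn _ _)).trans ?_
    rw [sum_three]
    simp only [hx, ht, Fin.append_left, Fin.append_right]
    induction i using Fin.addCases with
    | left i =>
      simp only [Fin.append_left]
      induction i using Fin.addCases with
      | left i₀ =>
        simp only [Fin.append_left, htA, gaa]
        have h2 : ∑ j', S 2 ![a i₀, b j'] ≤ ∑ j', K * (P i₀ 0 + Q j' 0) ^ (-(2 * Δ)) :=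
          Finset.sum_le_sum fun j' _ => (gab i₀ j').1
        have h3 : ∑ k, S 2 ![a i₀, col k] ≤ F (P i₀ 0) :=
          (Finset.sum_le_sum fun k _ => (gac i₀ k).1).trans (sumA i₀)
        linarith
      | right j₀ =>
        simp only [Fin.append_right, htB, gbb]
        have h1 : ∑ i', S 2 ![b j₀, a i'] ≤ ∑ i', K * (P i' 0 + Q j₀ 0) ^ (-(2 * Δ)) :=
          Finset.sum_le_sum fun i' _ => (gab i' j₀).2
        have h3 : ∑ k, S 2 ![b j₀, col k] ≤ F (Q j₀ 0) :=
          (Finset.sum_le_sum fun k _ => (gbc j₀ k).1).trans (sumB j₀)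
        linarith
    | right k₀ =>
      simp only [Fin.append_right]
      have h1 : ∑ i', S 2 ![col k₀, a i'] ≤
          ∑ i', K * (P i' 0 + 2 * ((idx k₀ : ℝ) + J) + 1) ^ (-(2 * Δ)) :=
        Finset.sum_le_sum fun i' _ => (gac i' k₀).2
      have h2 : ∑ j', S 2 ![col k₀, b j'] ≤
          ∑ j', K * (Q j' 0 + 2 * ((J : ℝ) - 1 - idx k₀) + 1) ^ (-(2 * Δ)) :=
        Finset.sum_le_sum fun j' _ => (gbc j' k₀).2
      have h3 := sumC k₀
      have h4 : spec k₀ ≤ R * spec k₀ := le_mul_of_one_le_left (hspec0 k₀) hR1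
      simp only [hspec] at h4 ⊢
      linarith
  /- conclusion -/
  calc S ((p + q) + (J + J)) x ≤ ∏ i, t i := hrow _ x t ht1 ht2
    _ = (∏ i, tA i) * (∏ j, tB j) * ∏ k, R * (1 + spec k) := by
      rw [prod_three]
      simp only [ht, Fin.append_left, Fin.append_right]
    _ ≤ (∏ i, tA i) * (∏ j, tB j) * (R ^ (J + J) * Real.exp (∑ k, spec k)) := by
      refine mul_le_mul_of_nonneg_left ?_ hM0
      simpa using prod_mul_one_add_le hR0 spec hspec0
    _ ≤ (∏ i, tA i) * (∏ j, tB j) * (R ^ (J + J) * Real.exp E₀) :=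
      mul_le_mul_of_nonneg_left
        (mul_le_mul_of_nonneg_left (Real.exp_le_exp.mpr hspec_sum) (pow_nonneg hR0 _)) hM0
    _ = (∏ i, tA i) * (∏ j, tB j) * Real.exp E₀ * R ^ (2 * J) := by
      rw [two_mul]
      ring

end Summit.CriticalPhenomena.Ising3DConformalLimit.Cruxes.RotationUpgradeFromTwoPoint.NullLaplacianEdgeGaussianity

end
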